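import Literature.Barriers.RiemannHypothesis.TuranPartialSumsLiouville
import Literature.NumberTheory.LFunctions.HaselgroveNumericsProofs
import Literature.NumberTheory.LFunctions.LiouvilleHarmonicSum
import Literature.NumberTheory.LFunctions.PrimeNumberTheoremErrorTermProofs
import HarnessLib

/-!
# Turán's Theorem III holds — vacuously, and without Montgomery: `Turan1948_thmIII_holds`

Proof-only sibling of `Literature/Barriers/RiemannHypothesis/TuranPartialSums.lean` (the barrier file
that vendors the named fact `Turan1948_thmIII := ∀ ε, 0 < ε → ε < 1/2 → TuranHypothesisIII ε →
RiemannHypothesis`, "if `U_N(s) ≠ 0` for `σ ≥ 1 + N^{−1/2+ε}` (`N > N₀(ε)`) then the Riemann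
Hypothesis is true", Montgomery 1983 §1 (1) quoting Turán 1948 Theorem III). That file proves the
fact only from Montgomery's (unproved, vendored) theorem (`Turan1948_thmIII_of_montgomeryThm`); the
siblings `TuranPartialSumsThmIIIProofs.lean` / `…Status.lean` prove the source-faithful readings.

Here the fact is DISCHARGED AS STATED, unconditionally: for every `ε < 1/2` the hypothesis
`TuranHypothesisIII ε` is false (`not_TuranHypothesisIII_holds`), because

* **`exists_zetaPartialSum_zero_beyond_log_cube`** — there are `κ > 0` and `M₀` such that for EVERY
  `M ≥ M₀` the section `ζ_M(s) = ∑_{n ≤ M} n^{−s}` has zeros `s` with `Re s > 1 + κ/(log M)³`, of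
  arbitrarily large height.

This is weaker in the rate than Montgomery's `1 + (4/π − 1 − ε) log log M/log M` (Montgomery 1983,
Theorem), but it is proved here from results that are ALL theorems of the tree, by the real-twist
construction of Granville–Soundararajan's "negative truncations" (their §2, (2.1)), transported to
`ζ_M` by Bohr's equivalence theorem:

1. **Haselgrove 1958** (tree: `Literature.NumberTheory.LFunctions.frequently_liouvilleHarmonicSum_natCast_neg`,
   a certified computation): some `a ≥ 1` has `T(a) = ∑_{n ≤ a} λ(n)/n = −δ < 0`.
2. **Granville–Soundararajan 2007, §2**: for `M > (a+1)²` let `χ = χ_{a,M}` be the completely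
   multiplicative `±1`-valued function with `χ(p) = +1` for the primes `M/(a+1) < p ≤ M/a` and
   `χ(p) = −1 = λ(p)` for all other primes. An `n ≤ M` is divisible by at most one such `p`, to the
   first power, with cofactor `ℓ = n/p ≤ a`; hence the exact identity (their (2.1), here at a real
   `σ` instead of `σ = 1`)
   `∑_{n ≤ M} χ(n) n^{−σ} = T_σ(M) + 2 (∑_{M/(a+1) < p ≤ M/a} p^{−σ}) · T_σ(a)`,
   `T_σ(x) := ∑_{n ≤ x} λ(n) n^{−σ}` (`realTwistedSum_twist_eq`).
3. `|T_σ(x) − T(x)| ≤ (σ − 1) log x (1 + log x)` for `σ ≥ 1` (`abs_realTwistedSum_liouville_sub_le`), so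
   `T_σ(a) ≤ −δ/2` once `σ − 1` is small; `T(M) ≪ e^{−c√log M}` (tree:
   `abs_sum_liouville_div_le_exp_neg_sqrt_log`, from the de la Vallée Poussin zero-free region), so
   `T_σ(M) ≤ δ/(16(a+1) log M) + 2(σ−1) log² M`; and the prime number theorem for `ϑ` with the
   de la Vallée Poussin error term (tree: `ChebyshevThetaDeLaValleePoussin_holds`) gives
   `∑_{M/(a+1) < p ≤ M/a} log p = ϑ(M/a) − ϑ(M/(a+1)) ≥ M/(2a(a+1))`, whence
   `∑ p^{−σ} ≥ 1/(4(a+1) log M)` for `(σ − 1) log M ≤ 1/2`. For `(σ − 1)(log M)³ ≤ κ` the twisted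
   sum is therefore `≤ (1/16 + 1/32 − 1/4) δ/((a+1) log M) < 0` (`realTwistedSum_twist_neg`).
4. **Bohr / Turán transfer** (tree: `exists_zetaPartialSum_zero_of_realTwistedSum_neg`, Apostol Thm.
   8.20): a real `±1` completely multiplicative twist negative at `σ₁` forces zeros of `ζ_M` with
   `Re s > σ₁`. With `σ₁ = 1 + M^{−1/2+ε}` (admissible for large `M` since
   `M^{−1/2+ε} (log M)³ → 0` for `ε < 1/2`) this contradicts `TuranHypothesisIII ε`.

So Turán's criterion `Turan1948_thmIII` holds (vacuously), like Theorem I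
(`Turan1948_criterion_of_TuranPartialSums`) — now unconditionally in the tree.

Remarks. (i) By Granville–Soundararajan's Theorem 1, `∑_{n ≤ x} f(n)/n ≥ −(log log x)^{−3/5}`
for EVERY completely multiplicative `f` with values in `[−1, 1]` (large `x`), while their negative
example (Theorem 1, second half: some `±1`-valued `f = f_x` has `∑_{n ≤ x} f(n)/n ≤ −c/log x`) is
exactly the twist used here, built on Haselgrove's negative value of Turán's sum `T`; Montgomery's
complex twists need no such input, at the price of his §§3–4. (ii) Everything here inherits the
`native_decide` axioms of the certified Haselgrove computation (`HaselgroveNumericsProofs.lean`),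
exactly as `Haselgrove1958_signChanges_holds` does (proposal flag `computational`).

## References

* [GranvilleSoundararajan2007Truncations] A. Granville, K. Soundararajan, *Negative values of
  truncations to L(1,χ)*, Clay Math. Proc. 7 (2007), 141–148 = arXiv:math/0508361: Theorem 1 and §2,
  (2.1) (read, pp. 1–2 of the arXiv version).
* [Montgomery1983] H. L. Montgomery, *Zeros of approximations to the zeta function*, §1 (1) and
  Theorem (read).
* [Turan1948] P. Turán, Danske Vid. Selsk. Mat.-Fys. Medd. 24 (1948), no. 17, Theorem III (read).
* [HaselgroveMathematika1958] C. B. Haselgrove, *A disproof of a conjecture of Pólya*, Mathematika 5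
  (1958), 141–145.
* [Apostol1990] T. M. Apostol, *Modular Functions and Dirichlet Series*, 2nd ed., §8.13 Thm. 8.20.
* [MontgomeryVaughan2007] H. L. Montgomery, R. C. Vaughan, *Multiplicative Number Theory I*,
  Theorem 6.9 and §6.2.1 Exercise 11.
-/

noncomputable section

open Finset Real Filter ArithmeticFunction
open scoped Topology

namespace Literature.Barriers.RiemannHypothesis

open Literature.NumberTheory.LFunctions

namespace ThmIIIHolds

/-! ## The Granville–Soundararajan twist `χ_P = λ · (−1)^{∑_{p ∈ P} v_p}` -/

/-- The twist `χ_P(n) = λ(n) (−1)^{∑_{p ∈ P} v_p(n)}` — the completely multiplicative `±1`-valued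
function with `χ_P(p) = +1` for `p ∈ P` and `χ_P(p) = −1` at the other primes — is completely
multiplicative. [cite: GranvilleSoundararajan2007Truncations, §2] -/
theorem twist_mul (P : Finset ℕ) : ∀ m n : ℕ, m ≠ 0 → n ≠ 0 →
    (liouville (m * n) : ℝ) * (-1) ^ (∑ p ∈ P, (m * n).factorization p) =
      ((liouville m : ℝ) * (-1) ^ (∑ p ∈ P, m.factorization p)) *
        ((liouville n : ℝ) * (-1) ^ (∑ p ∈ P, n.factorization p)) := by
  intro m n hm hn
  rw [Nat.factorization_mul hm hn, liouville_apply_mul]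
  simp only [Finsupp.coe_add, Pi.add_apply, Finset.sum_add_distrib, pow_add]
  push_cast
  ring

/-- … and unimodular at the primes. [cite: GranvilleSoundararajan2007Truncations, §2] -/
theorem abs_twist_prime (P : Finset ℕ) : ∀ p : ℕ, p.Prime →
    |(liouville p : ℝ) * (-1) ^ (∑ q ∈ P, p.factorization q)| = 1 := by
  intro p hp
  rw [abs_mul, abs_liouville_real_prime p hp, abs_pow, abs_neg, abs_one, one_pow, mul_one]

/-- `λ(p) = −1` as a real number. [folklore] -/
theorem liouville_real_prime {p : ℕ} (hp : p.Prime) : (liouville p : ℝ) = -1 := by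
  rw [liouville_apply hp.ne_zero, cardFactors_apply_prime hp]
  push_cast
  ring

/-! ## The window of flipped primes `M/(a+1) < p ≤ M/a` and the exact identity (2.1) -/

/-- Membership in the window, in multiplication form: `M < p (a+1)` and `p a ≤ M`. [folklore] -/
theorem mem_window {a M p : ℕ} (ha : 1 ≤ a) :
    p ∈ (Ioc (M / (a + 1)) (M / a)).filter (fun p : ℕ ↦ p.Prime) ↔
      p.Prime ∧ M < p * (a + 1) ∧ p * a ≤ M := by
  rw [mem_filter, mem_Ioc, Nat.div_lt_iff_lt_mul (by omega), Nat.le_div_iff_mul_le (by omega)]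
  tauto

/-- For `M > (a+1)²` the flipped primes exceed `a + 1`. [folklore] -/
theorem lt_of_mem_window {a M p : ℕ} (hM : (a + 1) ^ 2 < M)
    (hp : p ∈ (Ioc (M / (a + 1)) (M / a)).filter (fun p : ℕ ↦ p.Prime)) : a + 1 < p := by
  have h1 : M / (a + 1) < p := (mem_Ioc.1 (mem_filter.1 hp).1).1
  have h2 : a + 1 ≤ M / (a + 1) :=
    (Nat.le_div_iff_mul_le (by omega)).2 (by nlinarith [hM.le])
  omega

/-- **Splitting `∑_{n ≤ M}` along the window** (`M > (a+1)²`): the `n ≤ M` divisible by some flipped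
prime `p` are exactly the `p ℓ`, `1 ≤ ℓ ≤ a`, each written uniquely; the others are untouched.
("If `n ≤ x` then `f(n) = λ(n)` unless `n = pℓ` for a (unique) prime `p ∈ (x/(N+1), x/N]`".)
[cite: GranvilleSoundararajan2007Truncations, §2] -/
theorem sum_Icc_eq_sum_filter_add {a M : ℕ} (ha : 1 ≤ a) (hM : (a + 1) ^ 2 < M) (g : ℕ → ℝ) :
    ∑ n ∈ Icc 1 M, g n =
      ∑ n ∈ (Icc 1 M).filter
          (fun n : ℕ ↦ ∀ p ∈ (Ioc (M / (a + 1)) (M / a)).filter (fun p : ℕ ↦ p.Prime), ¬ p ∣ n), g n +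
        ∑ p ∈ (Ioc (M / (a + 1)) (M / a)).filter (fun p : ℕ ↦ p.Prime), ∑ ℓ ∈ Icc 1 a, g (p * ℓ) := by
  set P := (Ioc (M / (a + 1)) (M / a)).filter (fun p : ℕ ↦ p.Prime) with hP
  rw [← Finset.sum_filter_add_sum_filter_not (Icc 1 M) (fun n ↦ ∀ p ∈ P, ¬ p ∣ n) g]
  congr 1
  have hwin : ∀ p ∈ P, p.Prime ∧ M < p * (a + 1) ∧ p * a ≤ M := fun p hp ↦ (mem_window ha).1 hp
  have hbig : ∀ p ∈ P, a + 1 < p := fun p hp ↦ lt_of_mem_window hM hp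
  have hset : (Icc 1 M).filter (fun n ↦ ¬ ∀ p ∈ P, ¬ p ∣ n) =
      P.biUnion (fun p ↦ (Icc 1 a).image (fun ℓ ↦ p * ℓ)) := by
    ext n
    simp only [mem_filter, mem_Icc, mem_biUnion, mem_image, not_forall, not_not, exists_prop]
    constructor
    · rintro ⟨⟨hn1, hnM⟩, p, hp, hpn⟩
      obtain ⟨-, hMp, -⟩ := hwin p hp
      obtain ⟨ℓ, rfl⟩ := hpn
      refine ⟨p, hp, ℓ, ⟨?_, ?_⟩, rfl⟩
      · rcases Nat.eq_zero_or_pos ℓ with h | h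
        · simp [h] at hn1
        · exact h
      · by_contra h
        push Not at h
        have : p * (a + 1) ≤ p * ℓ := Nat.mul_le_mul_left p h
        omega
    · rintro ⟨p, hp, ℓ, ⟨hℓ1, hℓa⟩, rfl⟩
      obtain ⟨hpr, -, hpa⟩ := hwin p hp
      refine ⟨⟨?_, ?_⟩, p, hp, dvd_mul_right p ℓ⟩
      · exact Nat.one_le_iff_ne_zero.2 (Nat.mul_ne_zero hpr.ne_zero (by omega))
      · exact (Nat.mul_le_mul_left p hℓa).trans hpa
  rw [hset, Finset.sum_biUnion]
  · refine Finset.sum_congr rfl fun p hp ↦ ?_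
    rw [Finset.sum_image]
    intro x _ y _ hxy
    exact Nat.eq_of_mul_eq_mul_left (hwin p hp).1.pos hxy
  · intro p hp p' hp' hne
    rw [Finset.mem_coe] at hp hp'
    simp only [Function.onFun]
    rw [Finset.disjoint_left]
    intro n hn hn'
    obtain ⟨ℓ, -, rfl⟩ := mem_image.1 hn
    obtain ⟨ℓ', hℓ', heq⟩ := mem_image.1 hn'
    have hpr := (hwin p hp).1
    have hpr' := (hwin p' hp').1
    have hdvd : p ∣ p' * ℓ' := ⟨ℓ, heq⟩
    rcases (Nat.Prime.dvd_mul hpr).1 hdvd with h | h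
    · exact hne ((Nat.prime_dvd_prime_iff_eq hpr hpr').1 h)
    · have hℓ'pos : 0 < ℓ' := (mem_Icc.1 hℓ').1
      have h1 := Nat.le_of_dvd hℓ'pos h
      have h2 := (mem_Icc.1 hℓ').2
      have h3 := hbig p hp
      omega

/-- **Granville–Soundararajan's identity (2.1), at a real `σ`**: for `M > (a+1)²`,
`∑_{n ≤ M} χ(n) n^{−σ} = T_σ(M) + 2 (∑_{M/(a+1) < p ≤ M/a} p^{−σ}) T_σ(a)` with
`T_σ(x) = ∑_{n ≤ x} λ(n) n^{−σ}` (the source has `σ = 1` and writes `T(a) = −δ`).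
[cite: GranvilleSoundararajan2007Truncations, §2 (2.1)] -/
theorem realTwistedSum_twist_eq {a M : ℕ} (ha : 1 ≤ a) (hM : (a + 1) ^ 2 < M) (σ : ℝ) :
    realTwistedSum (fun n ↦ (liouville n : ℝ) *
        (-1) ^ (∑ p ∈ (Ioc (M / (a + 1)) (M / a)).filter (fun p : ℕ ↦ p.Prime), n.factorization p)) M σ =
      realTwistedSum (fun n ↦ (liouville n : ℝ)) M σ +
        2 * (∑ p ∈ (Ioc (M / (a + 1)) (M / a)).filter (fun p : ℕ ↦ p.Prime), (p : ℝ) ^ (-σ)) *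
          realTwistedSum (fun n ↦ (liouville n : ℝ)) a σ := by
  set P := (Ioc (M / (a + 1)) (M / a)).filter (fun p : ℕ ↦ p.Prime) with hP
  have hwin : ∀ p ∈ P, p.Prime ∧ M < p * (a + 1) ∧ p * a ≤ M := fun p hp ↦ (mem_window ha).1 hp
  have hbig : ∀ p ∈ P, a + 1 < p := fun p hp ↦ lt_of_mem_window hM hp
  -- the exponent `∑_{p ∈ P} v_p` vanishes off the window multiples and on `ℓ ≤ a`, and is `1` at `p ∈ P`
  have hcnt0 : ∀ n ∈ (Icc 1 M).filter (fun n ↦ ∀ p ∈ P, ¬ p ∣ n),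
      (∑ p ∈ P, n.factorization p) = 0 := fun n hn ↦
    Finset.sum_eq_zero fun p hp ↦ Nat.factorization_eq_zero_of_not_dvd ((mem_filter.1 hn).2 p hp)
  have hcntl : ∀ ℓ ∈ Icc 1 a, (∑ p ∈ P, ℓ.factorization p) = 0 := by
    intro ℓ hℓ
    refine Finset.sum_eq_zero fun p hp ↦ Nat.factorization_eq_zero_of_not_dvd fun h ↦ ?_
    have hℓpos : 0 < ℓ := (mem_Icc.1 hℓ).1
    have h1 := Nat.le_of_dvd hℓpos h
    have h2 := (mem_Icc.1 hℓ).2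
    have h3 := hbig p hp
    omega
  have hcntp : ∀ p ∈ P, (∑ q ∈ P, p.factorization q) = 1 := by
    intro p hp
    rw [Nat.Prime.factorization (hwin p hp).1]
    simp only [Finsupp.single_apply]
    rw [Finset.sum_ite_eq P p (fun _ ↦ (1 : ℕ))]
    simp [hp]
  unfold realTwistedSum
  rw [sum_Icc_eq_sum_filter_add ha hM (fun n ↦ ((liouville n : ℝ) *
      (-1) ^ (∑ p ∈ P, n.factorization p)) * (n : ℝ) ^ (-σ)),
    sum_Icc_eq_sum_filter_add ha hM (fun n ↦ (liouville n : ℝ) * (n : ℝ) ^ (-σ))]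
  have hA : ∑ n ∈ (Icc 1 M).filter (fun n ↦ ∀ p ∈ P, ¬ p ∣ n),
      ((liouville n : ℝ) * (-1) ^ (∑ p ∈ P, n.factorization p)) * (n : ℝ) ^ (-σ) =
      ∑ n ∈ (Icc 1 M).filter (fun n ↦ ∀ p ∈ P, ¬ p ∣ n), (liouville n : ℝ) * (n : ℝ) ^ (-σ) := by
    refine Finset.sum_congr rfl fun n hn ↦ ?_
    rw [hcnt0 n hn, pow_zero, mul_one]
  have hB : ∀ p ∈ P, ∀ ℓ ∈ Icc 1 a,
      ((liouville (p * ℓ) : ℝ) * (-1) ^ (∑ q ∈ P, (p * ℓ).factorization q)) *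
          ((p * ℓ : ℕ) : ℝ) ^ (-σ) =
        (p : ℝ) ^ (-σ) * ((liouville ℓ : ℝ) * (ℓ : ℝ) ^ (-σ)) := by
    intro p hp ℓ hℓ
    have hp0 : p ≠ 0 := (hwin p hp).1.ne_zero
    have hℓ0 : ℓ ≠ 0 := by have := (mem_Icc.1 hℓ).1; omega
    rw [twist_mul P p ℓ hp0 hℓ0, hcntp p hp, hcntl ℓ hℓ, liouville_real_prime (hwin p hp).1,
      Nat.cast_mul, Real.mul_rpow (Nat.cast_nonneg p) (Nat.cast_nonneg ℓ)]
    ring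
  have hB' : ∀ p ∈ P, ∀ ℓ ∈ Icc 1 a,
      (liouville (p * ℓ) : ℝ) * ((p * ℓ : ℕ) : ℝ) ^ (-σ) =
        -((p : ℝ) ^ (-σ) * ((liouville ℓ : ℝ) * (ℓ : ℝ) ^ (-σ))) := by
    intro p hp ℓ hℓ
    rw [liouville_apply_mul, Int.cast_mul, liouville_real_prime (hwin p hp).1, Nat.cast_mul,
      Real.mul_rpow (Nat.cast_nonneg p) (Nat.cast_nonneg ℓ)]
    ring
  rw [hA, Finset.sum_congr rfl (fun p hp ↦ Finset.sum_congr rfl (fun ℓ hℓ ↦ hB p hp ℓ hℓ)),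
    Finset.sum_congr rfl (fun p hp ↦ Finset.sum_congr rfl (fun ℓ hℓ ↦ hB' p hp ℓ hℓ))]
  simp only [Finset.sum_neg_distrib, ← Finset.mul_sum, ← Finset.sum_mul]
  rw [← hP]
  ring

/-! ## Moving off `σ = 1`: `|T_σ(x) − T(x)| ≤ (σ − 1) log x (1 + log x)` -/

/-- `0 ≤ n^{−1} − n^{−σ} ≤ (σ − 1) log n · n^{−1}` for `n ≥ 1`, `σ ≥ 1` (from `e^{−t} ≥ 1 − t`).
[folklore] -/
theorem inv_sub_rpow_neg_le {n : ℕ} (hn : 1 ≤ n) {σ : ℝ} (hσ : 1 ≤ σ) :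
    0 ≤ (n : ℝ) ^ (-(1 : ℝ)) - (n : ℝ) ^ (-σ) ∧
      (n : ℝ) ^ (-(1 : ℝ)) - (n : ℝ) ^ (-σ) ≤ (σ - 1) * Real.log n * (n : ℝ) ^ (-(1 : ℝ)) := by
  have hn1 : (1 : ℝ) ≤ n := by exact_mod_cast hn
  have hn0 : (0 : ℝ) < n := by positivity
  have hsplit : (n : ℝ) ^ (-σ) = (n : ℝ) ^ (-(1 : ℝ)) * (n : ℝ) ^ (-(σ - 1)) := by
    rw [← Real.rpow_add hn0]
    congr 1
    ring
  have hle1 : (n : ℝ) ^ (-(σ - 1)) ≤ 1 := Real.rpow_le_one_of_one_le_of_nonpos hn1 (by linarith)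
  have hge : 1 - (σ - 1) * Real.log n ≤ (n : ℝ) ^ (-(σ - 1)) := by
    rw [Real.rpow_def_of_pos hn0]
    have := Real.add_one_le_exp (Real.log n * (-(σ - 1)))
    nlinarith [this]
  have hpos1 : 0 < (n : ℝ) ^ (-(1 : ℝ)) := Real.rpow_pos_of_pos hn0 _
  rw [hsplit]
  constructor
  · nlinarith
  · nlinarith

/-- `∑_{n ≤ N} 1/n ≤ 1 + log N`. [folklore] -/
theorem sum_Icc_rpow_neg_one_le (N : ℕ) :
    ∑ n ∈ Icc 1 N, (n : ℝ) ^ (-(1 : ℝ)) ≤ 1 + Real.log N := by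
  have h := harmonic_le_one_add_log N
  rw [harmonic_eq_sum_Icc] at h
  push_cast at h
  convert h using 2 with n
  rw [Real.rpow_neg_one]

/-- **`|T_σ(N) − T(N)| ≤ (σ − 1) log N (1 + log N)`** for `σ ≥ 1`, where
`T_σ(N) = ∑_{n ≤ N} λ(n) n^{−σ}`. [folklore] -/
theorem abs_realTwistedSum_liouville_sub_le (N : ℕ) {σ : ℝ} (hσ : 1 ≤ σ) :
    |realTwistedSum (fun n ↦ (liouville n : ℝ)) N σ -
        realTwistedSum (fun n ↦ (liouville n : ℝ)) N 1| ≤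
      (σ - 1) * (Real.log N * (1 + Real.log N)) := by
  unfold realTwistedSum
  rw [← Finset.sum_sub_distrib]
  have hterm : ∀ n ∈ Icc 1 N,
      |(liouville n : ℝ) * (n : ℝ) ^ (-σ) - (liouville n : ℝ) * (n : ℝ) ^ (-(1 : ℝ))| ≤
        (σ - 1) * Real.log N * (n : ℝ) ^ (-(1 : ℝ)) := by
    intro n hn
    have hn1 := (mem_Icc.1 hn).1
    have hnN := (mem_Icc.1 hn).2
    obtain ⟨h0, h1⟩ := inv_sub_rpow_neg_le hn1 hσ
    have hn0 : (0 : ℝ) < n := by exact_mod_cast hn1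
    have hpos1 : 0 < (n : ℝ) ^ (-(1 : ℝ)) := Real.rpow_pos_of_pos hn0 _
    have hlog : Real.log n ≤ Real.log N := Real.log_le_log hn0 (by exact_mod_cast hnN)
    have hlog0 : 0 ≤ Real.log n := Real.log_nonneg (by exact_mod_cast hn1)
    rw [← mul_sub, abs_mul, abs_sub_comm, abs_of_nonneg h0]
    calc |(liouville n : ℝ)| * ((n : ℝ) ^ (-(1 : ℝ)) - (n : ℝ) ^ (-σ))
        ≤ 1 * ((n : ℝ) ^ (-(1 : ℝ)) - (n : ℝ) ^ (-σ)) :=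
          mul_le_mul_of_nonneg_right (LiouvilleSum.abs_liouville_le_one n) h0
      _ ≤ (σ - 1) * Real.log n * (n : ℝ) ^ (-(1 : ℝ)) := by rw [one_mul]; exact h1
      _ ≤ (σ - 1) * Real.log N * (n : ℝ) ^ (-(1 : ℝ)) := by
          have hs : 0 ≤ σ - 1 := by linarith
          gcongr
  have hone : ∀ n ∈ Icc 1 N, (liouville n : ℝ) * (n : ℝ) ^ (-(1 : ℝ)) =
      (liouville n : ℝ) * (n : ℝ) ^ (-(1 : ℝ)) := fun _ _ ↦ rfl
  calc |∑ n ∈ Icc 1 N, ((liouville n : ℝ) * (n : ℝ) ^ (-σ) - (liouville n : ℝ) * (n : ℝ) ^ (-(1 : ℝ)))|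
      ≤ ∑ n ∈ Icc 1 N, |(liouville n : ℝ) * (n : ℝ) ^ (-σ) - (liouville n : ℝ) * (n : ℝ) ^ (-(1 : ℝ))| :=
        Finset.abs_sum_le_sum_abs _ _
    _ ≤ ∑ n ∈ Icc 1 N, (σ - 1) * Real.log N * (n : ℝ) ^ (-(1 : ℝ)) := Finset.sum_le_sum hterm
    _ = (σ - 1) * Real.log N * ∑ n ∈ Icc 1 N, (n : ℝ) ^ (-(1 : ℝ)) := by rw [Finset.mul_sum]
    _ ≤ (σ - 1) * Real.log N * (1 + Real.log N) := by
        have hs : 0 ≤ σ - 1 := by linarith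
        have hl : 0 ≤ Real.log N := Real.log_natCast_nonneg N
        exact mul_le_mul_of_nonneg_left (sum_Icc_rpow_neg_one_le N) (mul_nonneg hs hl)
    _ = (σ - 1) * (Real.log N * (1 + Real.log N)) := by ring

/-- `T(N) = ∑_{n ≤ N} λ(n)/n` is the real Liouville twist at `σ = 1`, in the `∑ λ(n)/n` notation of
`abs_sum_liouville_div_le_exp_neg_sqrt_log`. [folklore] -/
theorem realTwistedSum_liouville_one_eq (N : ℕ) :
    realTwistedSum (fun n ↦ (liouville n : ℝ)) N 1 = ∑ n ∈ Icc 1 N, (liouville n : ℝ) / n := by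
  unfold realTwistedSum
  refine Finset.sum_congr rfl fun n _ ↦ ?_
  rw [Real.rpow_neg_one, div_eq_mul_inv]

/-! ## The window of primes via the prime number theorem for `ϑ` -/

/-- `∑_{M/(a+1) < p ≤ M/a} log p = ϑ(M/a) − ϑ(M/(a+1))`. [folklore] -/
theorem sum_log_window_eq (a M : ℕ) (ha : 1 ≤ a) :
    ∑ p ∈ (Ioc (M / (a + 1)) (M / a)).filter (fun p : ℕ ↦ p.Prime), Real.log p =
      Chebyshev.theta ((M : ℝ) / a) - Chebyshev.theta ((M : ℝ) / ((a + 1 : ℕ) : ℝ)) := by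
  have hfl1 : ⌊(M : ℝ) / a⌋₊ = M / a := by rw [Nat.floor_div_natCast, Nat.floor_natCast]
  have hfl2 : ⌊(M : ℝ) / ((a + 1 : ℕ) : ℝ)⌋₊ = M / (a + 1) := by
    rw [Nat.floor_div_natCast, Nat.floor_natCast]
  have hle : M / (a + 1) ≤ M / a := Nat.div_le_div_left (by omega) (by omega)
  rw [Chebyshev.theta, Chebyshev.theta, hfl1, hfl2, eq_sub_iff_add_eq', ← Finset.sum_union,
    ← Finset.filter_union, Finset.Ioc_union_Ioc_eq_Ioc (Nat.zero_le _) hle]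
  exact Finset.disjoint_filter_filter (Finset.Ioc_disjoint_Ioc_of_le le_rfl)

/-- **The window holds `≫ M` worth of primes** (prime number theorem with the de la Vallée Poussin
error term, tree: `ChebyshevThetaDeLaValleePoussin_holds`): for large `M`,
`∑_{M/(a+1) < p ≤ M/a} log p ≥ M/(2a(a+1))` ("the prime number theorem readily gives that
`∑_{x/(N+1) < p ≤ x/N} 1/p ≍ 1/(N log x)`"). [cite: GranvilleSoundararajan2007Truncations, §2]
[cite: MontgomeryVaughan2007, Theorem 6.9 (6.13)] -/
theorem exists_window_lower {a : ℕ} (ha : 1 ≤ a) : ∃ M₀ : ℕ, ∀ M : ℕ, M₀ ≤ M →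
    (M : ℝ) / (2 * a * (a + 1)) ≤
      ∑ p ∈ (Ioc (M / (a + 1)) (M / a)).filter (fun p : ℕ ↦ p.Prime), Real.log p := by
  obtain ⟨c, hc, C, hθ⟩ := ChebyshevThetaDeLaValleePoussin_holds
  have hC : 0 ≤ C := by
    by_contra hC
    push Not at hC
    have h := hθ 2 le_rfl
    have h2 : C * 2 / Real.exp (c * Real.sqrt (Real.log 2)) < 0 :=
      div_neg_of_neg_of_pos (by linarith) (Real.exp_pos _)
    linarith [abs_nonneg (Chebyshev.theta 2 - 2)]
  have hu : Tendsto (fun M : ℕ ↦ (M : ℝ) / ((a + 1 : ℕ) : ℝ)) atTop atTop :=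
    tendsto_natCast_atTop_atTop.atTop_div_const (by positivity)
  have hE : Tendsto (fun M : ℕ ↦
      Real.exp (c * Real.sqrt (Real.log ((M : ℝ) / ((a + 1 : ℕ) : ℝ))))) atTop atTop :=
    Real.tendsto_exp_atTop.comp
      ((Real.tendsto_sqrt_atTop.comp (Real.tendsto_log_atTop.comp hu)).const_mul_atTop hc)
  obtain ⟨M₀, hM₀⟩ := eventually_atTop.1
    ((hu.eventually_ge_atTop 2).and (hE.eventually_ge_atTop (4 * C * (a + 1))))
  refine ⟨M₀, fun M hM ↦ ?_⟩
  obtain ⟨hu2, hE4⟩ := hM₀ M hM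
  rw [sum_log_window_eq a M ha]
  set u₁ : ℝ := (M : ℝ) / ((a + 1 : ℕ) : ℝ) with hu₁
  set u₂ : ℝ := (M : ℝ) / a with hu₂
  set E : ℝ := Real.exp (c * Real.sqrt (Real.log u₁)) with hEdef
  have ha0 : (0 : ℝ) < a := by exact_mod_cast ha
  have hM0 : (0 : ℝ) ≤ M := by positivity
  have hu12 : u₁ ≤ u₂ := by
    rw [hu₁, hu₂]
    push_cast
    exact div_le_div_of_nonneg_left hM0 ha0 (by linarith)
  have hu2' : 2 ≤ u₂ := hu2.trans hu12
  have hEpos : 0 < E := Real.exp_pos _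
  have hE2 : E ≤ Real.exp (c * Real.sqrt (Real.log u₂)) :=
    Real.exp_le_exp.2 (mul_le_mul_of_nonneg_left
      (Real.sqrt_le_sqrt (Real.log_le_log (by linarith) hu12)) hc.le)
  have h1 : |Chebyshev.theta u₁ - u₁| ≤ C * u₁ / E := hθ u₁ hu2
  have h2 : |Chebyshev.theta u₂ - u₂| ≤ C * u₂ / E :=
    (hθ u₂ hu2').trans (div_le_div_of_nonneg_left (by positivity) hEpos hE2)
  have hdiff : u₂ - u₁ = (M : ℝ) / (a * (a + 1)) := by
    rw [hu₁, hu₂]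
    push_cast
    field_simp
    ring
  have hkey : C * (u₁ + u₂) / E ≤ (M : ℝ) / (2 * a * (a + 1)) := by
    rw [div_le_div_iff₀ hEpos (by positivity)]
    calc C * (u₁ + u₂) * (2 * a * (a + 1)) ≤ C * (2 * ((M : ℝ) / a)) * (2 * a * (a + 1)) := by
          gcongr
          linarith
      _ = (M : ℝ) * (4 * C * (a + 1)) := by
          field_simp
          ring
      _ ≤ (M : ℝ) * E := by gcongr
  have hθ1 := (abs_le.1 h1).2
  have hθ2 := (abs_le.1 h2).1
  have hsplit : C * u₁ / E + C * u₂ / E = C * (u₁ + u₂) / E := by ring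
  have hhalf : (M : ℝ) / (a * (a + 1)) - (M : ℝ) / (2 * a * (a + 1)) = (M : ℝ) / (2 * a * (a + 1)) := by
    field_simp
    ring
  linarith

/-! ## The twisted section is negative near `σ = 1` -/

/-- **Core estimate.** With `T(a) ≤ −δ < 0`, `M > (a+1)²`, `M ≥ 3`, the window inequality
`∑ log p ≥ M/(2a(a+1))`, `T(M) ≤ δ/(16(a+1) log M)`, and `σ ≥ 1` so close to `1` that
`(σ−1) log M ≤ 1/2`, `(σ−1) log a (1 + log a) ≤ δ/2`, `(σ−1) log M (1 + log M) ≤ δ/(32(a+1) log M)`: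
the twisted section satisfies `∑_{n ≤ M} χ(n) n^{−σ} < 0` — indeed
`≤ (1/16 + 1/32 − 1/4) δ/((a+1) log M)`. [cite: GranvilleSoundararajan2007Truncations, §2] -/
theorem realTwistedSum_twist_neg {a M : ℕ} (ha : 1 ≤ a) (hM : (a + 1) ^ 2 < M) (hM3 : 3 ≤ M)
    {δ : ℝ} (hδ : 0 < δ) (hTa : realTwistedSum (fun n ↦ (liouville n : ℝ)) a 1 ≤ -δ)
    (hwin : (M : ℝ) / (2 * a * (a + 1)) ≤
      ∑ p ∈ (Ioc (M / (a + 1)) (M / a)).filter (fun p : ℕ ↦ p.Prime), Real.log p)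
    (hTM : realTwistedSum (fun n ↦ (liouville n : ℝ)) M 1 ≤ δ / (16 * (a + 1) * Real.log M))
    {σ : ℝ} (hσ : 1 ≤ σ) (hs1 : (σ - 1) * Real.log M ≤ 1 / 2)
    (hs2 : (σ - 1) * (Real.log a * (1 + Real.log a)) ≤ δ / 2)
    (hs3 : (σ - 1) * (Real.log M * (1 + Real.log M)) ≤ δ / (32 * (a + 1) * Real.log M)) :
    realTwistedSum (fun n ↦ (liouville n : ℝ) *
        (-1) ^ (∑ p ∈ (Ioc (M / (a + 1)) (M / a)).filter (fun p : ℕ ↦ p.Prime), n.factorization p))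
      M σ < 0 := by
  set P := (Ioc (M / (a + 1)) (M / a)).filter (fun p : ℕ ↦ p.Prime) with hP
  set L : ℝ := Real.log M with hLdef
  have hM3' : (3 : ℝ) ≤ M := by exact_mod_cast hM3
  have hMpos : (0 : ℝ) < M := by linarith
  have hL1 : 1 ≤ L := LiouvilleSum.one_le_log hM3'
  have hLpos : 0 < L := by linarith
  have ha0 : (0 : ℝ) < a := by exact_mod_cast ha
  have ha1 : (0 : ℝ) < a + 1 := by linarith
  have hs0 : 0 ≤ σ - 1 := by linarith
  -- (1) `T_σ(a) ≤ −δ/2`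
  have hTaσ : realTwistedSum (fun n ↦ (liouville n : ℝ)) a σ ≤ -δ / 2 := by
    have h := (abs_le.1 (abs_realTwistedSum_liouville_sub_le a hσ)).2
    linarith
  -- (2) `T_σ(M) ≤ δ/(16(a+1)L) + δ/(32(a+1)L)`
  have hTMσ : realTwistedSum (fun n ↦ (liouville n : ℝ)) M σ ≤
      δ / (16 * (a + 1) * L) + δ / (32 * (a + 1) * L) := by
    have h := (abs_le.1 (abs_realTwistedSum_liouville_sub_le M hσ)).2
    linarith
  -- (3) the window sum `S = ∑ p^{−σ} ≥ 1/(4(a+1)L)`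
  have hwinP : ∀ p ∈ P, p.Prime ∧ M < p * (a + 1) ∧ p * a ≤ M := fun p hp ↦ (mem_window ha).1 hp
  have hterm : ∀ p ∈ P, (a : ℝ) / (2 * M) ≤ (p : ℝ) ^ (-σ) := by
    intro p hp
    obtain ⟨hpr, -, hpa⟩ := hwinP p hp
    have hp0 : (0 : ℝ) < p := by exact_mod_cast hpr.pos
    have hpa' : (p : ℝ) * a ≤ M := by exact_mod_cast hpa
    have hpM : (p : ℝ) ≤ M := by nlinarith [show (1 : ℝ) ≤ a from by exact_mod_cast ha]
    have hsplit : (p : ℝ) ^ (-σ) = (p : ℝ) ^ (-(1 : ℝ)) * (p : ℝ) ^ (-(σ - 1)) := by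
      rw [← Real.rpow_add hp0]
      congr 1
      ring
    -- `p^{−(σ−1)} ≥ 1 − (σ−1) log p ≥ 1 − (σ−1) L ≥ 1/2`
    have hlogp : Real.log p ≤ L := Real.log_le_log hp0 hpM
    have hlogp0 : 0 ≤ Real.log p := Real.log_nonneg (by exact_mod_cast hpr.one_lt.le)
    have hfac : 1 / 2 ≤ (p : ℝ) ^ (-(σ - 1)) := by
      rw [Real.rpow_def_of_pos hp0]
      have h1 := Real.add_one_le_exp (Real.log p * (-(σ - 1)))
      have h2 : (σ - 1) * Real.log p ≤ (σ - 1) * L := mul_le_mul_of_nonneg_left hlogp hs0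
      nlinarith
    have hinv : (a : ℝ) / M ≤ (p : ℝ) ^ (-(1 : ℝ)) := by
      rw [Real.rpow_neg_one, ← one_div, div_le_div_iff₀ hMpos hp0]
      nlinarith
    have haM : 0 ≤ (a : ℝ) / M := by positivity
    calc (a : ℝ) / (2 * M) = (a : ℝ) / M * (1 / 2) := by
          field_simp
      _ ≤ (p : ℝ) ^ (-(1 : ℝ)) * (p : ℝ) ^ (-(σ - 1)) :=
          mul_le_mul hinv hfac (by norm_num) (haM.trans hinv)
      _ = (p : ℝ) ^ (-σ) := hsplit.symm
  set S : ℝ := ∑ p ∈ P, (p : ℝ) ^ (-σ) with hSdef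
  have hcard_le : (P.card : ℝ) * ((a : ℝ) / (2 * M)) ≤ S := by
    have h := Finset.card_nsmul_le_sum P (fun p ↦ (p : ℝ) ^ (-σ)) _ hterm
    rwa [nsmul_eq_mul] at h
  have hlog_le : ∑ p ∈ P, Real.log p ≤ (P.card : ℝ) * L := by
    have h := Finset.sum_le_card_nsmul P (fun p ↦ Real.log (p : ℝ)) L ?_
    · rwa [nsmul_eq_mul] at h
    · intro p hp
      obtain ⟨hpr, -, hpa⟩ := hwinP p hp
      have hp0 : (0 : ℝ) < p := by exact_mod_cast hpr.pos
      have hpa' : (p : ℝ) * a ≤ M := by exact_mod_cast hpa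
      have hpM : (p : ℝ) ≤ M := by nlinarith [show (1 : ℝ) ≤ a from by exact_mod_cast ha]
      exact Real.log_le_log hp0 hpM
  -- `#P ≥ M/(2a(a+1)L)` and so `S ≥ 1/(4(a+1)L)`
  have hcard : (M : ℝ) / (2 * a * (a + 1) * L) ≤ P.card := by
    rw [div_le_iff₀ (by positivity)]
    have h := hwin.trans hlog_le
    rw [div_le_iff₀ (by positivity)] at h
    nlinarith
  have hS : 1 / (4 * (a + 1) * L) ≤ S := by
    calc 1 / (4 * (a + 1) * L) = (M : ℝ) / (2 * a * (a + 1) * L) * ((a : ℝ) / (2 * M)) := by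
          field_simp
          ring
      _ ≤ (P.card : ℝ) * ((a : ℝ) / (2 * M)) :=
          mul_le_mul_of_nonneg_right hcard (by positivity)
      _ ≤ S := hcard_le
  -- (4) assemble
  rw [realTwistedSum_twist_eq ha hM σ]
  have hS0 : (0 : ℝ) ≤ 1 / (4 * (a + 1) * L) := by positivity
  have hT0 : realTwistedSum (fun n ↦ (liouville n : ℝ)) a σ ≤ 0 := by linarith
  have h2S : 2 * S * realTwistedSum (fun n ↦ (liouville n : ℝ)) a σ ≤
      2 * (1 / (4 * (a + 1) * L)) * (-δ / 2) := by
    calc 2 * S * realTwistedSum (fun n ↦ (liouville n : ℝ)) a σ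
        ≤ 2 * (1 / (4 * (a + 1) * L)) * realTwistedSum (fun n ↦ (liouville n : ℝ)) a σ := by
          have := mul_le_mul_of_nonpos_right hS hT0
          linarith
      _ ≤ 2 * (1 / (4 * (a + 1) * L)) * (-δ / 2) := by
          have := mul_le_mul_of_nonneg_left hTaσ hS0
          linarith
  have hkey : δ / (16 * (a + 1) * L) + δ / (32 * (a + 1) * L) +
      2 * (1 / (4 * (a + 1) * L)) * (-δ / 2) = -(5 / 32) * (δ / ((a + 1) * L)) := by
    field_simp
    ring
  have hKpos : 0 < δ / ((a + 1) * L) := by positivity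
  linarith

/-- `T(M) ≤ c₀/log M` for all large `M`, for every `c₀ > 0` (from `T(M) ≪ e^{−c√log M}`, tree:
`abs_sum_liouville_div_le_exp_neg_sqrt_log`). [cite: MontgomeryVaughan2007, §6.2.1 Exercise 11] -/
theorem eventually_realTwistedSum_liouville_one_le {c₀ : ℝ} (hc₀ : 0 < c₀) :
    ∀ᶠ M : ℕ in atTop, realTwistedSum (fun n ↦ (liouville n : ℝ)) M 1 ≤ c₀ / Real.log M := by
  obtain ⟨c, hc, C, hT⟩ := abs_sum_liouville_div_le_exp_neg_sqrt_log
  -- `u² e^{−cu} → 0`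
  have h1 : Tendsto (fun u : ℝ ↦ u ^ 2 * Real.exp (-(c * u))) atTop (𝓝 0) := by
    have h := ((Real.tendsto_pow_mul_exp_neg_atTop_nhds_zero 2).comp
      (tendsto_id.const_mul_atTop hc)).const_mul (c ^ 2)⁻¹
    rw [mul_zero] at h
    refine h.congr' (Eventually.of_forall fun u ↦ ?_)
    simp only [Function.comp_apply, id_eq]
    field_simp
  have h2 : Tendsto (fun M : ℕ ↦ Real.sqrt (Real.log M)) atTop atTop :=
    Real.tendsto_sqrt_atTop.comp (Real.tendsto_log_atTop.comp tendsto_natCast_atTop_atTop)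
  have h3 : Tendsto (fun M : ℕ ↦ C * (Real.log M * Real.exp (-(c * Real.sqrt (Real.log M)))))
      atTop (𝓝 0) := by
    have h := (h1.comp h2).const_mul C
    rw [mul_zero] at h
    refine h.congr' ?_
    filter_upwards [eventually_ge_atTop 1] with M hM
    simp only [Function.comp_apply]
    rw [Real.sq_sqrt (Real.log_natCast_nonneg M)]
  have h4 : ∀ᶠ M : ℕ in atTop,
      C * (Real.log M * Real.exp (-(c * Real.sqrt (Real.log M)))) ≤ c₀ :=
    h3.eventually (Iic_mem_nhds hc₀)
  filter_upwards [h4, eventually_ge_atTop 3] with M hM hM3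
  have hM3' : (3 : ℝ) ≤ M := by exact_mod_cast hM3
  have hMpos : (0 : ℝ) < M := by linarith
  have hL : 0 < Real.log M := Real.log_pos (by linarith)
  have hTM := hT M (by linarith)
  rw [Nat.floor_natCast] at hTM
  rw [realTwistedSum_liouville_one_eq, le_div_iff₀ hL]
  calc (∑ n ∈ Icc 1 M, (liouville n : ℝ) / n) * Real.log M
      ≤ |∑ n ∈ Icc 1 M, (liouville n : ℝ) / n| * Real.log M :=
        mul_le_mul_of_nonneg_right (le_abs_self _) hL.le
    _ ≤ C * Real.exp (-c * Real.sqrt (Real.log M)) * Real.log M :=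
        mul_le_mul_of_nonneg_right hTM hL.le
    _ = C * (Real.log M * Real.exp (-(c * Real.sqrt (Real.log M)))) := by rw [neg_mul]; ring
    _ ≤ c₀ := hM

/-- **Negative real twists for all large `M`.** There are `κ > 0` and `M₀` such that for every
`M ≥ M₀` and every real `σ ≥ 1` with `(σ − 1)(log M)³ ≤ κ` some completely multiplicative
`±1`-valued twist `χ` (Granville–Soundararajan's `χ_{a,M}`, `a` a Haselgrove integer) has
`∑_{n ≤ M} χ(n) n^{−σ} < 0`. [cite: GranvilleSoundararajan2007Truncations, Theorem 1 and §2]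
[cite: HaselgroveMathematika1958, main theorem] -/
theorem exists_realTwistedSum_neg : ∃ κ : ℝ, 0 < κ ∧ ∃ M₀ : ℕ, 3 ≤ M₀ ∧ ∀ M : ℕ, M₀ ≤ M →
    ∀ σ : ℝ, 1 ≤ σ → (σ - 1) * Real.log M ^ 3 ≤ κ →
      ∃ χ : ℕ → ℝ, (∀ m n : ℕ, m ≠ 0 → n ≠ 0 → χ (m * n) = χ m * χ n) ∧
        (∀ p : ℕ, p.Prime → |χ p| = 1) ∧ realTwistedSum χ M σ < 0 := by
  -- a Haselgrove integer `a`: `T(a) = −δ < 0`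
  obtain ⟨a, ha, hneg⟩ := frequently_liouvilleHarmonicSum_natCast_neg.forall_exists_of_atTop 1
  rw [liouvilleHarmonicSum_natCast_eq_realTwistedSum] at hneg
  set δ : ℝ := -realTwistedSum (fun n ↦ (liouville n : ℝ)) a 1 with hδdef
  have hδ : 0 < δ := by rw [hδdef]; linarith
  have hTa : realTwistedSum (fun n ↦ (liouville n : ℝ)) a 1 ≤ -δ := by rw [hδdef]; linarith
  have ha1 : (0 : ℝ) < a + 1 := by positivity
  set La : ℝ := Real.log a * (1 + Real.log a) with hLa
  have hLa0 : 0 ≤ La := by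
    have : 0 ≤ Real.log a := Real.log_natCast_nonneg a
    positivity
  -- the three thresholds in `M`
  obtain ⟨M₁, hM₁⟩ := exists_window_lower ha
  obtain ⟨M₂, hM₂⟩ := eventually_atTop.1
    (eventually_realTwistedSum_liouville_one_le (c₀ := δ / (16 * (a + 1))) (by positivity))
  set κ : ℝ := min (1 / 2) (min (δ / (2 * (La + 1))) (δ / (64 * (a + 1)))) with hκdef
  have hκ : 0 < κ := lt_min (by norm_num) (lt_min (by positivity) (by positivity))
  have hκ1 : κ ≤ 1 / 2 := min_le_left _ _
  have hκ2 : κ ≤ δ / (2 * (La + 1)) := (min_le_right _ _).trans (min_le_left _ _)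
  have hκ3 : κ ≤ δ / (64 * (a + 1)) := (min_le_right _ _).trans (min_le_right _ _)
  refine ⟨κ, hκ, max (max ((a + 1) ^ 2 + 1) 3) (max M₁ M₂), ?_, fun M hM σ hσ hsκ ↦ ?_⟩
  · exact (le_max_right _ _).trans (le_max_left _ _)
  have hMa : (a + 1) ^ 2 < M := by
    have := (le_max_left _ _).trans ((le_max_left _ _).trans hM)
    omega
  have hM3 : 3 ≤ M := (le_max_right _ _).trans ((le_max_left _ _).trans hM)
  have hMM₁ : M₁ ≤ M := (le_max_left _ _).trans ((le_max_right _ _).trans hM)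
  have hMM₂ : M₂ ≤ M := (le_max_right _ _).trans ((le_max_right _ _).trans hM)
  have hM3' : (3 : ℝ) ≤ M := by exact_mod_cast hM3
  have hMpos : (0 : ℝ) < M := by linarith
  set L : ℝ := Real.log M with hLdef
  have hL1 : 1 ≤ L := LiouvilleSum.one_le_log hM3'
  have hLpos : 0 < L := by linarith
  have hs0 : 0 ≤ σ - 1 := by linarith
  -- from `(σ−1) L³ ≤ κ`: the three smallness conditions
  have hL3 : L ≤ L ^ 3 := le_self_pow₀ hL1 (by norm_num)
  have hsL : (σ - 1) * L ≤ κ := (mul_le_mul_of_nonneg_left hL3 hs0).trans hsκ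
  have hs_le : σ - 1 ≤ κ := by
    have : (σ - 1) * 1 ≤ (σ - 1) * L := mul_le_mul_of_nonneg_left hL1 hs0
    linarith
  have hs1 : (σ - 1) * Real.log M ≤ 1 / 2 := hsL.trans hκ1
  have hs2 : (σ - 1) * (Real.log a * (1 + Real.log a)) ≤ δ / 2 := by
    rw [← hLa]
    calc (σ - 1) * La ≤ κ * La := mul_le_mul_of_nonneg_right hs_le hLa0
      _ ≤ δ / (2 * (La + 1)) * La := mul_le_mul_of_nonneg_right hκ2 hLa0
      _ ≤ δ / 2 := by
          rw [div_mul_eq_mul_div, div_le_div_iff₀ (by positivity) (by norm_num)]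
          nlinarith
  have hs3 : (σ - 1) * (Real.log M * (1 + Real.log M)) ≤ δ / (32 * (a + 1) * Real.log M) := by
    rw [← hLdef]
    have h1 : (σ - 1) * (L * (1 + L)) ≤ 2 * ((σ - 1) * L ^ 3) / L := by
      rw [le_div_iff₀ hLpos]
      have : L * (1 + L) * L ≤ 2 * L ^ 3 := by nlinarith
      nlinarith
    calc (σ - 1) * (L * (1 + L)) ≤ 2 * ((σ - 1) * L ^ 3) / L := h1
      _ ≤ 2 * (δ / (64 * (a + 1))) / L := by gcongr; exact hsκ.trans hκ3
      _ = δ / (32 * (a + 1) * L) := by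
          field_simp
          ring
  have hTM : realTwistedSum (fun n ↦ (liouville n : ℝ)) M 1 ≤ δ / (16 * (a + 1) * Real.log M) := by
    have := hM₂ M hMM₂
    rwa [div_div] at this
  refine ⟨fun n ↦ (liouville n : ℝ) *
      (-1) ^ (∑ p ∈ (Ioc (M / (a + 1)) (M / a)).filter (fun p : ℕ ↦ p.Prime), n.factorization p),
    twist_mul _, abs_twist_prime _, ?_⟩
  exact realTwistedSum_twist_neg ha hMa hM3 hδ hTa (hM₁ M hMM₁) hTM hσ hs1 hs2 hs3

end ThmIIIHolds

open ThmIIIHolds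

/-! ## Zeros of `ζ_M` beyond `1 + κ/log³ M`, and Theorem III -/

/-- **Zeros of the sections far to the right of `σ = 1`, unconditionally.** There are `κ > 0` and
`M₀` such that for every `M ≥ M₀` and every `T`, the section `ζ_M(s) = ∑_{n ≤ M} n^{−s}` has a
zero `s` with `Re s > 1 + κ/(log M)³` and `|Im s| ≥ T`. (Montgomery 1983 proves the sharper
`Re s > 1 + (4/π − 1 − ε) log log M/log M`, by complex twists; this weaker rate follows from
Granville–Soundararajan's real twist, Haselgrove's theorem, the prime number theorem and Bohr's
equivalence theorem, all theorems of the tree.)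
[cite: GranvilleSoundararajan2007Truncations, Theorem 1 and §2] [cite: Montgomery1983, §1 Theorem]
[cite: Apostol1990, §8.13 proof of Thm. 8.20] -/
theorem exists_zetaPartialSum_zero_beyond_log_cube : ∃ κ : ℝ, 0 < κ ∧ ∃ M₀ : ℕ, ∀ M : ℕ,
    M₀ ≤ M → ∀ T : ℝ, ∃ s : ℂ, zetaPartialSum M s = 0 ∧
      1 + κ / Real.log M ^ 3 < s.re ∧ T ≤ |s.im| := by
  obtain ⟨κ, hκ, M₀, hM₀3, h⟩ := exists_realTwistedSum_neg
  refine ⟨κ, hκ, M₀, fun M hM T ↦ ?_⟩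
  have hM3 : (3 : ℝ) ≤ M := by exact_mod_cast hM₀3.trans hM
  have hL : 0 < Real.log M := Real.log_pos (by linarith)
  have hL3 : 0 < Real.log M ^ 3 := by positivity
  obtain ⟨χ, hmul, hχ, hneg⟩ := h M hM (1 + κ / Real.log M ^ 3)
    (le_add_of_nonneg_right (by positivity)) (by rw [add_sub_cancel_left, div_mul_cancel₀ _ hL3.ne'])
  exact exists_zetaPartialSum_zero_of_realTwistedSum_neg hmul hχ (by omega) hneg T

/-- **The hypothesis of Turán's Theorem III fails for every `ε < 1/2`** — unconditionally (compare
`not_TuranHypothesisIII_of_montgomeryThm`, which assumes Montgomery's theorem): for large `M`,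
`M^{−1/2+ε} (log M)³ ≤ κ`, so `ζ_M` vanishes somewhere in `σ > 1 + M^{−1/2+ε}`.
[cite: Montgomery1983, §1 (1)] [cite: GranvilleSoundararajan2007Truncations, Theorem 1 and §2] -/
theorem not_TuranHypothesisIII_holds {ε : ℝ} (hε : ε < 1 / 2) : ¬ TuranHypothesisIII ε := by
  rintro ⟨N₀, hIII⟩
  obtain ⟨κ, hκ, M₀, hM₀3, h⟩ := exists_realTwistedSum_neg
  -- `M^{−(1/2−ε)} log³ M → 0`
  have hlim : Tendsto (fun M : ℕ ↦ (M : ℝ) ^ (-(1 / 2 : ℝ) + ε) * Real.log M ^ 3) atTop (𝓝 0) := by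
    have hs : 0 < 1 / 2 - ε := by linarith
    have hlo := (isLittleO_log_rpow_rpow_atTop 3 hs).tendsto_div_nhds_zero
    have hnat := hlo.comp tendsto_natCast_atTop_atTop
    refine hnat.congr' ?_
    filter_upwards [eventually_ge_atTop 1] with M hM
    have hM0 : (0 : ℝ) ≤ M := by positivity
    simp only [Function.comp_apply]
    rw [show (-(1 / 2 : ℝ) + ε) = -(1 / 2 - ε) by ring, Real.rpow_neg hM0, div_eq_mul_inv, mul_comm]
    norm_cast
  obtain ⟨M, hMle, hMκ⟩ := (((eventually_ge_atTop (max N₀ M₀))).and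
    (hlim.eventually (Iic_mem_nhds hκ))).exists
  have hMN₀ : N₀ ≤ M := (le_max_left _ _).trans hMle
  have hMM₀ : M₀ ≤ M := (le_max_right _ _).trans hMle
  have hpow : 0 ≤ (M : ℝ) ^ (-(1 / 2 : ℝ) + ε) := Real.rpow_nonneg (by positivity) _
  obtain ⟨χ, hmul, hχ, hneg⟩ := h M hMM₀ (1 + (M : ℝ) ^ (-(1 / 2 : ℝ) + ε))
    (le_add_of_nonneg_right hpow) (by rwa [add_sub_cancel_left])
  obtain ⟨s, hs0, hsre, -⟩ :=
    exists_zetaPartialSum_zero_of_realTwistedSum_neg hmul hχ (by omega) hneg 0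
  exact hIII M hMN₀ s hsre.le hs0

/-- **Turán 1948, Theorem III — the vendored fact `Turan1948_thmIII` HOLDS** (vacuously: its
hypothesis `TuranHypothesisIII ε` is false for every `ε < 1/2`, `not_TuranHypothesisIII_holds`),
unconditionally and without Montgomery's theorem. [cite: Montgomery1983, §1 (1)]
[cite: Turan1948, Theorem III] [cite: GranvilleSoundararajan2007Truncations, Theorem 1 and §2] -/
theorem Turan1948_thmIII_holds : Turan1948_thmIII :=
  fun _ _ hε h ↦ (not_TuranHypothesisIII_holds hε h).elim

end Literature.Barriers.RiemannHypothesis
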